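import Summits.KontsevichZagierPeriods.KontsevichZagierPeriods.Theorems.SoloBlindLineMoves
import Literature.NumberTheory.Transcendental.KZProductIdeal
import Mathlib.RingTheory.Congruence.Defs
import Mathlib.FieldTheory.AlgebraicClosure
import HarnessLib

/-!
# The box sector of the Kontsevich–Zagier conjecture, I: the formal period ring

The formal group `FormalRep` of the Kontsevich–Zagier calculus carries the Fubini product
`[σ, f] * [τ, g] = [σ × τ, f ⊗ g]` (`KZProduct`), under which `relations` is a two-sided ideal and
`*` is commutative modulo `relations` (`KZProductIdeal`).  Here we add:

* `*` is **associative modulo relations** (`mul_mul_sub_mul_mul_mem_relations`): on generators,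
  `[r × (s × t)]` re-bracketed along `Fin (n + (m + l)) ≃ Fin (n + m + l)` *is* `[(r × s) × t]`,
  and re-indexing coordinates is a change-of-variables move;
* the point cell `K(1) = [pt, 1]` is a **unit modulo relations** (`constCell_one_mul_sub_mem_relations`);
* hence the **formal period ring** `Q = FormalRep ⧸ relations` (`SoloBlind.Q`, the quotient by
  the ring congruence `kzCon`) is a commutative ring, evaluation descends to a ring homomorphism
  `evalQ : Q →+* ℝ`, and the constant cells give a ring homomorphism
  `kappa : K₀ →+* Q` from the field `K₀` of real algebraic numbers, making `Q` a `K₀`-algebra with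
  `evalAlgHom : Q →ₐ[K₀] ℝ`.

This is the algebraic frame in which the box sector of Kontsevich–Zagier's period conjecture is
decided in the sequel files (`SoloBlindBoxGenerators`, `SoloBlindBoxBasis`,
`SoloBlindBoxTranscendence`, `SoloBlindBoxKernel`).

References: M. Kontsevich, D. Zagier, *Periods* (2001), §1.2, §4.1; M. Kontsevich, *Operads and
motives in deformation quantization* (1999), §4.3.
-/

noncomputable section

open MeasureTheory Set
open scoped BigOperators

namespace Summit.KontsevichZagierPeriods.KontsevichZagierPeriods.Theorems

open Literature.NumberTheory.Transcendental
open Literature.NumberTheory.Transcendental.KZ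

namespace SoloBlind

/-! ## Reduction of additive statements to generators -/

/-- An additive self-map of `FormalRep` that sends every generator into `relations` sends every
formal combination into `relations`. -/
theorem mem_relations_of_forall_of {f : FormalRep → FormalRep} (hadd : ∀ a b, f (a + b) = f a + f b)
    (h : ∀ x : Σ n, IntegralRep n, f (FreeAbelianGroup.of x) ∈ relations) (a : FormalRep) :
    f a ∈ relations := by
  have h0 : f 0 = 0 := by simpa using hadd 0 0
  have hneg : ∀ a, f (-a) = -f a := fun a =>
    eq_neg_of_add_eq_zero_right (by rw [← hadd, add_neg_cancel, h0])
  induction a using FreeAbelianGroup.induction_on with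
  | zero => rw [h0]; exact relations.zero_mem
  | of x => exact h x
  | neg x ih => rw [hneg]; exact relations.neg_mem ih
  | add x y hx hy => rw [hadd]; exact relations.add_mem hx hy

/-! ## Associativity of the product modulo relations -/

section assoc

variable {n m l : ℕ}

/-- Re-bracketing of coordinates, `Fin (n + (m + l)) ≃ Fin (n + m + l)`. -/
def assocEquiv (n m l : ℕ) : Fin (n + (m + l)) ≃ Fin (n + m + l) :=
  finCongr (Nat.add_assoc n m l).symm

/-- `assocEquiv` on the first block. -/
@[simp] theorem assocEquiv_castAdd (i : Fin n) :
    assocEquiv n m l (Fin.castAdd (m + l) i) = Fin.castAdd l (Fin.castAdd m i) :=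
  Fin.ext (by simp [assocEquiv])

/-- `assocEquiv` on the second block. -/
@[simp] theorem assocEquiv_natAdd_castAdd (j : Fin m) :
    assocEquiv n m l (Fin.natAdd n (Fin.castAdd l j)) = Fin.castAdd l (Fin.natAdd n j) :=
  Fin.ext (by simp [assocEquiv])

/-- `assocEquiv` on the third block. -/
@[simp] theorem assocEquiv_natAdd_natAdd (k : Fin l) :
    assocEquiv n m l (Fin.natAdd n (Fin.natAdd m k)) = Fin.natAdd (n + m) k :=
  Fin.ext (by simp [assocEquiv, Nat.add_assoc])

variable (r : IntegralRep n) (s : IntegralRep m) (t : IntegralRep l)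

/-- `[r × (s × t)]` re-bracketed along `assocEquiv` is `[(r × s) × t]`, as representations. -/
theorem prod_prod_reindex_assocEquiv :
    (r.prod (s.prod t)).reindex (assocEquiv n m l) = (r.prod s).prod t := by
  refine IntegralRep.ext' ?_ ?_
  · ext w
    simp only [IntegralRep.reindex_domain, IntegralRep.prod_domain, mem_setOf_eq,
      IntegralRep.mem_prodDomain, assocEquiv_castAdd, assocEquiv_natAdd_castAdd,
      assocEquiv_natAdd_natAdd, and_assoc]
  · ext w
    simp only [IntegralRep.reindex_integrand, IntegralRep.prod_integrand_eq,
      IntegralRep.prodFun_apply, assocEquiv_castAdd, assocEquiv_natAdd_castAdd,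
      assocEquiv_natAdd_natAdd, mul_assoc]

/-- **Associativity on generators**: `[r] * ([s] * [t]) − ([r] * [s]) * [t] ∈ relations`
(re-indexing coordinates is a change-of-variables move, `KZ.of_sub_of_reindex_mem_relations`). -/
theorem of_mul_of_mul_of_sub_mem_relations :
    of r * (of s * of t) - of r * of s * of t ∈ relations := by
  simp only [of_mul_of]
  rw [← prod_prod_reindex_assocEquiv]
  exact of_sub_of_reindex_mem_relations _ _

end assoc

/-- **The product of `FormalRep` is associative modulo relations**:
`a * (b * c) − (a * b) * c ∈ relations`. -/
theorem mul_mul_sub_mul_mul_mem_relations (a b c : FormalRep) :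
    a * (b * c) - a * b * c ∈ relations := by
  have h3 : ∀ (x y : Σ n, IntegralRep n) (c : FormalRep),
      FreeAbelianGroup.of x * (FreeAbelianGroup.of y * c) -
        FreeAbelianGroup.of x * FreeAbelianGroup.of y * c ∈ relations := by
    rintro ⟨n, r⟩ ⟨m, s⟩
    refine mem_relations_of_forall_of
      (f := fun c => of r * (of s * c) - of r * of s * c)
      (fun c c' => by simp only [mul_add]; abel) ?_
    rintro ⟨l, t⟩
    exact of_mul_of_mul_of_sub_mem_relations r s t
  have h2 : ∀ (x : Σ n, IntegralRep n) (c b : FormalRep),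
      FreeAbelianGroup.of x * (b * c) - FreeAbelianGroup.of x * b * c ∈ relations := by
    intro x c
    refine mem_relations_of_forall_of
      (f := fun b => FreeAbelianGroup.of x * (b * c) - FreeAbelianGroup.of x * b * c)
      (fun b b' => by simp only [mul_add, add_mul]; abel) ?_
    intro y
    exact h3 x y c
  refine mem_relations_of_forall_of (f := fun a => a * (b * c) - a * b * c)
    (fun a a' => by simp only [add_mul]; abel) ?_ a
  intro x
  exact h2 x c b

/-! ## The unit `K(1)` modulo relations -/

section unit

variable {n : ℕ} (r : IntegralRep n)

/-- The re-indexing `Fin n ≃ Fin (0 + n)` is `Fin.natAdd 0`. -/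
@[simp] theorem finCongr_zero_add_symm_apply (j : Fin n) :
    finCongr (Nat.zero_add n).symm j = Fin.natAdd 0 j :=
  Fin.ext (by simp)

/-- `[r]` re-indexed along `Fin n ≃ Fin (0 + n)` is `[pt, 1] × [r]`, as representations. -/
theorem reindex_eq_constCell_one_prod :
    r.reindex (finCongr (Nat.zero_add n).symm) = (constCell 1 isAlgebraic_one).prod r := by
  refine IntegralRep.ext' ?_ ?_
  · ext w
    simp only [IntegralRep.reindex_domain, mem_setOf_eq, finCongr_zero_add_symm_apply,
      IntegralRep.prod_domain, IntegralRep.mem_prodDomain, constCell_domain, mem_univ, true_and]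
  · ext w
    simp only [IntegralRep.reindex_integrand, finCongr_zero_add_symm_apply,
      IntegralRep.prod_integrand_eq, IntegralRep.prodFun_apply, constCell_integrand, one_mul]

/-- **`K(1)` is a left unit modulo relations on generators**: `[pt, 1] * [r] − [r] ∈ relations`. -/
theorem constCell_one_mul_of_sub_mem_relations :
    of (constCell 1 isAlgebraic_one) * of r - of r ∈ relations := by
  rw [of_mul_of, ← reindex_eq_constCell_one_prod, ← neg_sub]
  exact relations.neg_mem (of_sub_of_reindex_mem_relations _ _)

end unit

/-- **`K(1)` is a left unit modulo relations**: `[pt, 1] * a − a ∈ relations`. -/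
theorem constCell_one_mul_sub_mem_relations (a : FormalRep) :
    of (constCell 1 isAlgebraic_one) * a - a ∈ relations := by
  refine mem_relations_of_forall_of (f := fun a => of (constCell 1 isAlgebraic_one) * a - a)
    (fun a a' => by simp only [mul_add]; abel) ?_ a
  rintro ⟨n, r⟩
  exact constCell_one_mul_of_sub_mem_relations r

/-- The product of two point cells is the point cell of the product, as representations. -/
theorem constCell_prod_constCell {β γ : ℝ} (hβ : IsAlgebraic ℚ β) (hγ : IsAlgebraic ℚ γ) :
    (constCell β hβ).prod (constCell γ hγ) = constCell (β * γ) (hβ.mul hγ) := by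
  refine IntegralRep.ext' ?_ ?_
  · ext w
    simp only [IntegralRep.prod_domain, IntegralRep.mem_prodDomain, constCell_domain, mem_univ,
      and_self]
  · ext w
    simp only [IntegralRep.prod_integrand_eq, IntegralRep.prodFun_apply, constCell_integrand]

/-! ## The formal period ring `Q = FormalRep ⧸ relations` -/

/-- Congruence modulo `relations` is a ring congruence on `FormalRep` (it respects `+` trivially
and `*` because `relations` is a two-sided ideal, `KZ.mul_sub_mul_mem_relations`). -/
def kzCon : RingCon FormalRep where
  r a b := a - b ∈ relations
  iseqv :=
    ⟨fun a => by simp [relations.zero_mem],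
      fun {a b} h => by simpa using relations.neg_mem h,
      fun {a b c} h h' => by simpa using relations.add_mem h h'⟩
  mul' h h' := mul_sub_mul_mem_relations h h'
  add' {a b c d} h h' := by
    show a + c - (b + d) ∈ relations
    rw [add_sub_add_comm]
    exact relations.add_mem h h'

/-- **The formal period ring**: formal `ℤ`-combinations of integral representations modulo the
moves, `Q = FormalRep ⧸ relations`. -/
abbrev Q : Type := kzCon.Quotient

/-- The class map `FormalRep →+ Q`. -/
def mkQ : FormalRep →+ Q where
  toFun a := (a : kzCon.Quotient)
  map_zero' := rfl
  map_add' _ _ := rfl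

/-- `mkQ` is multiplicative. -/
theorem mkQ_mul (a b : FormalRep) : mkQ (a * b) = mkQ a * mkQ b := rfl

/-- Every class has a representative. -/
theorem mkQ_surjective : Function.Surjective mkQ := Quotient.mk''_surjective

/-- Two formal combinations have the same class iff they are congruent modulo `relations`. -/
theorem mkQ_eq_mkQ_iff {a b : FormalRep} : mkQ a = mkQ b ↔ a - b ∈ relations := kzCon.eq

/-- A formal combination has class `0` iff it is a relation. -/
theorem mkQ_eq_zero_iff {a : FormalRep} : mkQ a = 0 ↔ a ∈ relations := by
  rw [← map_zero mkQ, mkQ_eq_mkQ_iff, sub_zero]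

/-- The class of the point cell `K(1)`, the unit of `Q`. -/
def oneQ : Q := mkQ (of (constCell 1 isAlgebraic_one))

/-- Associativity in `Q`. -/
theorem Q.mul_assoc' (x y z : Q) : x * y * z = x * (y * z) := by
  obtain ⟨a, rfl⟩ := mkQ_surjective x
  obtain ⟨b, rfl⟩ := mkQ_surjective y
  obtain ⟨c, rfl⟩ := mkQ_surjective z
  rw [← mkQ_mul, ← mkQ_mul, ← mkQ_mul, ← mkQ_mul, mkQ_eq_mkQ_iff, ← neg_sub]
  exact relations.neg_mem (mul_mul_sub_mul_mul_mem_relations a b c)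

/-- Commutativity in `Q` (`KZ.mul_sub_mul_comm_mem_relations`). -/
theorem Q.mul_comm' (x y : Q) : x * y = y * x := by
  obtain ⟨a, rfl⟩ := mkQ_surjective x
  obtain ⟨b, rfl⟩ := mkQ_surjective y
  rw [← mkQ_mul, ← mkQ_mul, mkQ_eq_mkQ_iff]
  exact mul_sub_mul_comm_mem_relations a b

/-- `K(1)` is a left unit in `Q`. -/
theorem Q.one_mul' (x : Q) : oneQ * x = x := by
  obtain ⟨a, rfl⟩ := mkQ_surjective x
  rw [oneQ, ← mkQ_mul, mkQ_eq_mkQ_iff]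
  exact constCell_one_mul_sub_mem_relations a

/-- `K(1)` is a right unit in `Q`. -/
theorem Q.mul_one' (x : Q) : x * oneQ = x := by
  rw [Q.mul_comm', Q.one_mul']

/-- **`Q` is a commutative ring** (unit `K(1)`; associativity and commutativity modulo the
change-of-variables moves). -/
instance : CommRing Q :=
  { (inferInstance : NonUnitalNonAssocRing Q) with
    one := oneQ
    mul_assoc := Q.mul_assoc'
    one_mul := Q.one_mul'
    mul_one := Q.mul_one'
    mul_comm := Q.mul_comm' }

/-- The unit of `Q` is the class of `K(1)`. -/
theorem one_eq_mkQ : (1 : Q) = mkQ (of (constCell 1 isAlgebraic_one)) := rfl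

/-! ## Evaluation on `Q` -/

/-- **Evaluation descends to a ring homomorphism `Q →+* ℝ`** (Fubini: `KZ.eval_mul'`). -/
def evalQ : Q →+* ℝ where
  toFun x := Quotient.liftOn' x eval fun a b (h : a - b ∈ relations) =>
    sub_eq_zero.mp (by rw [← map_sub]; exact relations_le_ker_eval_holds h)
  map_one' := by
    change eval (of (constCell 1 isAlgebraic_one)) = 1
    rw [eval_of, value_constCell]
  map_mul' x y := by
    obtain ⟨a, rfl⟩ := mkQ_surjective x
    obtain ⟨b, rfl⟩ := mkQ_surjective y
    rw [← mkQ_mul]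
    exact eval_mul' a b
  map_zero' := by
    change eval 0 = 0
    exact map_zero eval
  map_add' x y := by
    obtain ⟨a, rfl⟩ := mkQ_surjective x
    obtain ⟨b, rfl⟩ := mkQ_surjective y
    rw [← map_add]
    exact map_add eval a b

/-- `evalQ [a] = eval a`. -/
@[simp] theorem evalQ_mkQ (a : FormalRep) : evalQ (mkQ a) = eval a := rfl

/-! ## Scalars: the field `K₀` of real algebraic numbers acts through point cells -/

/-- The field of real algebraic numbers (the relative algebraic closure of `ℚ` in `ℝ`). -/
abbrev K₀ : IntermediateField ℚ ℝ := algebraicClosure ℚ ℝ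

/-- Membership in `K₀` is algebraicity over `ℚ`. -/
theorem mem_K₀_iff {x : ℝ} : x ∈ K₀ ↔ IsAlgebraic ℚ x := mem_algebraicClosure_iff

/-- Elements of `K₀` are algebraic. -/
theorem K₀.isAlgebraic (β : K₀) : IsAlgebraic ℚ (β : ℝ) := mem_K₀_iff.mp β.2

/-- The point-cell class `κ(β) = [pt, β] ∈ Q` of a real algebraic number. -/
def kappaFun (β : K₀) : Q := mkQ (of (constCell (β : ℝ) (K₀.isAlgebraic β)))

/-- `κ(β) = [K(β)]` for any proof of algebraicity. -/
theorem kappaFun_eq (β : K₀) (h : IsAlgebraic ℚ (β : ℝ)) :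
    kappaFun β = mkQ (of (constCell (β : ℝ) h)) := rfl

/-- **Point cells form a ring homomorphism `κ : K₀ →+* Q`** (`K(β) * K(γ) = K(βγ)`,
`K(β + γ) ≡ K(β) + K(γ)`, `K(0) ≡ 0`, `K(1) = 1`). -/
def kappa : K₀ →+* Q where
  toFun := kappaFun
  map_one' := by
    rw [one_eq_mkQ, kappaFun]
    exact congrArg (fun c => mkQ (of c)) (constCell_congr (by simp))
  map_mul' β γ := by
    rw [kappaFun, kappaFun, kappaFun, ← mkQ_mul, of_mul_of, constCell_prod_constCell]
    exact congrArg (fun c => mkQ (of c)) (constCell_congr (by simp))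
  map_zero' := by
    rw [kappaFun, mkQ_eq_zero_iff]
    have h := constCell_zero (h0 := isAlgebraic_zero)
    rwa [constCell_congr (β := ((0 : K₀) : ℝ)) (by simp)] at h
  map_add' β γ := by
    rw [kappaFun, kappaFun, kappaFun, ← map_add, mkQ_eq_mkQ_iff]
    have h := constCell_add (hα := K₀.isAlgebraic β) (hβ := K₀.isAlgebraic γ)
      (hαβ := (K₀.isAlgebraic β).add (K₀.isAlgebraic γ))
    rw [constCell_congr (β := ((β + γ : K₀) : ℝ)) (by simp) (hβ := K₀.isAlgebraic (β + γ))] at h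
    simpa [sub_sub] using h

/-- `κ(β) = [K(β)]`. -/
theorem kappa_apply (β : K₀) (h : IsAlgebraic ℚ (β : ℝ)) :
    kappa β = mkQ (of (constCell (β : ℝ) h)) := rfl

/-- `Q` is a `K₀`-algebra through the point cells. -/
instance : Algebra K₀ Q := kappa.toAlgebra

/-- The structure map of the `K₀`-algebra `Q` is `κ`. -/
theorem algebraMap_eq_kappa : algebraMap K₀ Q = kappa := rfl

/-- `evalQ (κ β) = β`. -/
@[simp] theorem evalQ_kappa (β : K₀) : evalQ (kappa β) = β := by
  rw [kappa_apply β (K₀.isAlgebraic β), evalQ_mkQ, eval_of, value_constCell]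

/-- **Evaluation as a `K₀`-algebra homomorphism `Q →ₐ[K₀] ℝ`.** -/
def evalAlgHom : Q →ₐ[K₀] ℝ :=
  { evalQ with
    commutes' := fun β => by
      rw [algebraMap_eq_kappa]
      exact evalQ_kappa β }

/-- `evalAlgHom [a] = eval a`. -/
@[simp] theorem evalAlgHom_mkQ (a : FormalRep) : evalAlgHom (mkQ a) = eval a := rfl

/-- A class with value zero under `evalAlgHom`… (restatement used downstream):
`evalAlgHom x = evalQ x`. -/
theorem evalAlgHom_apply (x : Q) : evalAlgHom x = evalQ x := rfl

end SoloBlind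

end Summit.KontsevichZagierPeriods.KontsevichZagierPeriods.Theorems
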